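import Mathlib
import Literature.AlgebraicGeometry.Resolution.CobordantBlowupRegularCentre
import HarnessLib

/-!
# E2 centre, (G-0-U) `E2HomogeneousSpanBody`, part 1a: algebra of the weighted filtration `𝒥ₙ(u, w)`

[OURS · L1 W4.3 · DOOR `HypersurfaceCentreConstruction` stmt-ResolutionOfSingularities-19897 · E2 tier, centre piece
(C-c), hand (G-0-U) = board (o47-c-U) `E2HomogeneousSpanBody p ι J` of registrar res-L1-w43-plan-1's SPEC (Δ11)
(`L/res-L1-w43-plan-1/E2Step_split_sketch.lean` rev 9/10), DEAL 19:50:17Z → res-D-pv-031 (gen 11).  Pure commutative algebra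
over Mathlib and the Literature weighted filtration `𝒥ₙ(u, w) = (u^α : Σ αᵢ wᵢ ≥ n)` (…CobordantBlowupFiltration); nothing here
is a statement of the manuscript under adjudication [Hironaka2017]; candidate-design support, AI-written, weaker than expert review.]

For a family `u : ι → S` with weights `w` write `𝒥ₙ = 𝒥ₙ(u, w)`:
* `ideal_le_of_forall_mem` — MONOTONICITY: `u'ₖ ∈ 𝒥_{w'ₖ}(u, w)` for all `k` gives `𝒥ₙ(u', w') ≤ 𝒥ₙ(u, w)` for all `n`
  (so two families each lying in the other's filtration have the SAME filtration, `ideal_eq_of_forall_mem_of_forall_mem`);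
* `ideal_eq_iSup_span_mul` — FIRST-FACTOR DECOMPOSITION `𝒥ᵥ = Σᵢ uᵢ · 𝒥_{v - wᵢ}` (`v ≥ 1`, truncated subtraction), with the
  regroupings `ideal_le_span_image_sup_remainder` (`𝒥ᵥ ≤ (uₖ : wₖ = v) + 𝒥ᵥ₊₁ + Σ_{wⱼ < v} uⱼ 𝒥_{v-wⱼ}`),
  `ideal_le_span_image_sup_sq`, `remainder_le_span_image_sup_sq` (`… ≤ (uₖ : wₖ > v) + (u)²`) and the TAIL
  `ideal_add_le_span_mul` (`𝒥_{v+n} ≤ (u) 𝒥ᵥ` for `n ≥ max w`);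
* `exists_fun_of_mem_span_image` — coefficients from membership in the span of a sub-family.
-/

set_option linter.dupNamespace false -- mandated namespace of this single-conjunct summit

noncomputable section

open IsLocalRing Literature.AlgebraicGeometry.Resolution

namespace Summit.ResolutionOfSingularities.ResolutionOfSingularities.Cruxes.HypersurfaceCentreConstruction.LocalEngine

namespace E2Span

universe u v

/-! ## §1 Algebra of the weighted filtration -/

section Filtration

variable {S : Type u} [CommRing S] {ι : Type v} (u : ι → S) (w : ι → ℕ)

/-- A product `∏ xᵢ^{αᵢ}` with `xᵢ ∈ Jₐ₍ᵢ₎` lies in `J_{Σ αᵢ a(i)}` for an ideal filtration `J`. [folklore] -/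
theorem prod_pow_mem_ideal (F : IdealFiltration S) {κ : Type*} (x : κ → S) (a : κ → ℕ)
    (hx : ∀ i, x i ∈ F.ideal (a i)) (α : κ →₀ ℕ) :
    α.prod (fun i e => x i ^ e) ∈ F.ideal (α.sum fun i e => e * a i) := by
  classical
  induction α using Finsupp.induction with
  | zero => simp [F.ideal_zero]
  | single_add i b f hi hb ih =>
    rw [Finsupp.prod_add_index' (h := fun i e => x i ^ e) (fun _ => pow_zero _) (fun _ _ _ => pow_add _ _ _),
      Finsupp.sum_add_index' (h := fun i e => e * a i) (fun _ => zero_mul _) (fun _ _ _ => add_mul _ _ _),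
      Finsupp.prod_single_index (h := fun i e => x i ^ e) (pow_zero _),
      Finsupp.sum_single_index (h := fun i e => e * a i) (zero_mul _)]
    refine F.mul_le _ _ (Ideal.mul_mem_mul ?_ ih)
    -- `xᵢ ^ b ∈ J_{b a(i)}`
    clear ih hb hi
    induction b with
    | zero => simp [F.ideal_zero]
    | succ n ihn =>
      rw [pow_succ, Nat.succ_mul]
      exact F.mul_le _ _ (Ideal.mul_mem_mul ihn (hx i))

/-- **Monotonicity**: if every `u'ₖ` lies in `𝒥_{w'ₖ}(u, w)` then `𝒥ₙ(u', w') ≤ 𝒥ₙ(u, w)` for every `n`. [folklore] -/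
theorem ideal_le_of_forall_mem {ι' : Type*} (u' : ι' → S) (w' : ι' → ℕ)
    (h : ∀ k, u' k ∈ (weightedFiltration u w).ideal (w' k)) (n : ℕ) :
    (weightedFiltration u' w').ideal n ≤ (weightedFiltration u w).ideal n := by
  rw [weightedFiltration_ideal]
  refine Ideal.span_le.mpr ?_
  rintro _ ⟨α, hα, rfl⟩
  have hmem := prod_pow_mem_ideal (weightedFiltration u w) u' w' h α
  refine (weightedFiltration u w).antitone ?_ hmem
  rw [Finsupp.weight_apply] at hα
  simpa [smul_eq_mul] using hα

/-- Two families with each member of either in the right piece of the other's filtration have the SAME weighted filtration.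
[folklore] -/
theorem ideal_eq_of_forall_mem_of_forall_mem {ι' : Type*} (u' : ι' → S) (w' : ι' → ℕ)
    (h : ∀ k, u' k ∈ (weightedFiltration u w).ideal (w' k)) (h' : ∀ l, u l ∈ (weightedFiltration u' w').ideal (w l))
    (n : ℕ) : (weightedFiltration u' w').ideal n = (weightedFiltration u w).ideal n :=
  le_antisymm (ideal_le_of_forall_mem u w u' w' h n) (ideal_le_of_forall_mem u' w' u w h' n)

/-- **First-factor decomposition**: for `v ≥ 1`, `𝒥ᵥ(u, w) = Σᵢ uᵢ · 𝒥_{v - wᵢ}(u, w)` (truncated subtraction: the summand is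
`(uᵢ)` when `wᵢ ≥ v`). [folklore] -/
theorem ideal_eq_iSup_span_mul {v : ℕ} (hv : 1 ≤ v) :
    (weightedFiltration u w).ideal v = ⨆ i, Ideal.span {u i} * (weightedFiltration u w).ideal (v - w i) := by
  classical
  apply le_antisymm
  · rw [weightedFiltration_ideal]
    refine Ideal.span_le.mpr ?_
    rintro _ ⟨α, hα, rfl⟩
    -- a monomial of positive weight has a variable
    have hα0 : α ≠ 0 := by
      rintro rfl
      simp at hα
      omega
    obtain ⟨i, hi⟩ := Finsupp.ne_iff.mp hα0
    simp only [Finsupp.coe_zero, Pi.zero_apply] at hi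
    set β : ι →₀ ℕ := α - Finsupp.single i 1 with hβ
    have hαβ : α = Finsupp.single i 1 + β := by
      ext j
      simp only [hβ, Finsupp.coe_add, Finsupp.coe_tsub, Pi.add_apply, Pi.sub_apply, Finsupp.single_apply]
      split_ifs with h
      · subst h; omega
      · omega
    have hwt : v - w i ≤ Finsupp.weight w β := by
      have := congrArg (Finsupp.weight w) hαβ
      rw [map_add, Finsupp.weight_single, smul_eq_mul, one_mul] at this
      omega
    have hβmem : β.prod (fun i e => u i ^ e) ∈ (weightedFiltration u w).ideal (v - w i) :=
      Ideal.subset_span ⟨β, hwt, rfl⟩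
    have hprod : α.prod (fun i e => u i ^ e) = u i * β.prod (fun i e => u i ^ e) := by
      rw [hαβ, prod_pow_add, Finsupp.prod_single_index (h := fun i e => u i ^ e) (pow_zero _), pow_one]
    rw [SetLike.mem_coe, hprod]
    exact Ideal.mem_iSup_of_mem i (Ideal.mul_mem_mul (Ideal.mem_span_singleton_self _) hβmem)
  · refine iSup_le fun i => ?_
    calc Ideal.span {u i} * (weightedFiltration u w).ideal (v - w i)
        ≤ (weightedFiltration u w).ideal (w i) * (weightedFiltration u w).ideal (v - w i) :=
          Ideal.mul_mono_left ((Ideal.span_singleton_le_iff_mem _).mpr (mem_weightedFiltration_ideal u w i))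
      _ ≤ (weightedFiltration u w).ideal (w i + (v - w i)) := (weightedFiltration u w).mul_le _ _
      _ ≤ (weightedFiltration u w).ideal v := (weightedFiltration u w).antitone le_add_tsub

/-- For `w ≥ 1`, `𝒥ᵥ ≤ (u)` when `v ≥ 1`: every piece of positive degree lies in the ideal of the family. [folklore] -/
theorem ideal_le_span {v : ℕ} (hv : 1 ≤ v) : (weightedFiltration u w).ideal v ≤ Ideal.span (Set.range u) := by
  rw [ideal_eq_iSup_span_mul u w hv]
  refine iSup_le fun i => Ideal.mul_le_right.trans ?_
  exact Ideal.span_mono (Set.singleton_subset_iff.mpr ⟨i, rfl⟩)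

/-- **Tail**: if `n ≥ wᵢ` for all `i` then `𝒥_{v+n} ≤ (u) · 𝒥ᵥ` for `v + n ≥ 1`. [folklore] -/
theorem ideal_add_le_span_mul {n : ℕ} (hn : ∀ i, w i ≤ n) {v : ℕ} (hv : 1 ≤ v + n) :
    (weightedFiltration u w).ideal (v + n) ≤ Ideal.span (Set.range u) * (weightedFiltration u w).ideal v := by
  rw [ideal_eq_iSup_span_mul u w hv]
  refine iSup_le fun i => Ideal.mul_mono (Ideal.span_mono (Set.singleton_subset_iff.mpr ⟨i, rfl⟩))
    ((weightedFiltration u w).antitone ?_)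
  have := hn i
  omega

/-- `𝒥ᵥ ≤ (uₖ : wₖ ≥ v) + (u)²` for `v ≥ 1`: a monomial of weight `≥ v` is a single variable of weight `≥ v` or decomposable.
[folklore] -/
theorem ideal_le_span_image_sup_sq {v : ℕ} (hv : 1 ≤ v) :
    (weightedFiltration u w).ideal v ≤ Ideal.span (u '' {k | v ≤ w k}) ⊔ Ideal.span (Set.range u) ^ 2 := by
  rw [ideal_eq_iSup_span_mul u w hv]
  refine iSup_le fun i => ?_
  by_cases h : v ≤ w i
  · refine le_sup_left.trans' (Ideal.mul_le_right.trans (Ideal.span_mono ?_))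
    exact Set.singleton_subset_iff.mpr ⟨i, h, rfl⟩
  · refine le_sup_right.trans' ?_
    rw [pow_two]
    exact Ideal.mul_mono (Ideal.span_mono (Set.singleton_subset_iff.mpr ⟨i, rfl⟩))
      (ideal_le_span u w (by omega))

/-- `𝒥ᵥ ≤ (uₖ : wₖ = v) + remainderᵥ`, `remainderᵥ = 𝒥ᵥ₊₁ + Σ_{wⱼ < v} uⱼ 𝒥_{v - wⱼ}` (`v ≥ 1`): the first-factor decomposition
regrouped by the weight of the first factor. [folklore] -/
theorem ideal_le_span_image_sup_remainder {v : ℕ} (hv : 1 ≤ v) :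
    (weightedFiltration u w).ideal v ≤ Ideal.span (u '' {k | w k = v}) ⊔ ((weightedFiltration u w).ideal (v + 1) ⊔
      ⨆ (j : ι) (_ : w j < v), Ideal.span {u j} * (weightedFiltration u w).ideal (v - w j)) := by
  rw [ideal_eq_iSup_span_mul u w hv]
  refine iSup_le fun i => ?_
  rcases lt_trichotomy (w i) v with hlt | heq | hgt
  · exact le_sup_right.trans' (le_sup_right.trans' (le_iSup₂_of_le i hlt le_rfl))
  · have h0 : (weightedFiltration u w).ideal (v - w i) = ⊤ := by
      rw [heq, Nat.sub_self, (weightedFiltration u w).ideal_zero]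
    rw [h0, Ideal.mul_top]
    exact le_sup_left.trans' (Ideal.span_mono (Set.singleton_subset_iff.mpr ⟨i, heq, rfl⟩))
  · have h0 : (weightedFiltration u w).ideal (v - w i) = ⊤ := by
      rw [Nat.sub_eq_zero_of_le hgt.le, (weightedFiltration u w).ideal_zero]
    rw [h0, Ideal.mul_top]
    refine le_sup_right.trans' (le_sup_left.trans' ?_)
    exact ((Ideal.span_singleton_le_iff_mem _).mpr (mem_weightedFiltration_ideal u w i)).trans
      ((weightedFiltration u w).antitone (by omega))

/-- `remainderᵥ ≤ (uₖ : wₖ > v) + (u)²`. [folklore] -/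
theorem remainder_le_span_image_sup_sq (v : ℕ) :
    (weightedFiltration u w).ideal (v + 1) ⊔
        (⨆ (j : ι) (_ : w j < v), Ideal.span {u j} * (weightedFiltration u w).ideal (v - w j)) ≤
      Ideal.span (u '' {k | v < w k}) ⊔ Ideal.span (Set.range u) ^ 2 := by
  refine sup_le (ideal_le_span_image_sup_sq u w (by omega)) (iSup₂_le fun j hj => le_sup_right.trans' ?_)
  rw [pow_two]
  exact Ideal.mul_mono (Ideal.span_mono (Set.singleton_subset_iff.mpr ⟨j, rfl⟩)) (ideal_le_span u w (by omega))

/-- Coefficients from membership in the span of a sub-family: `x ∈ (uₖ : p k)` gives `x = Σ bₖ uₖ` with `bₖ = 0` off `p`.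
[folklore] -/
theorem exists_fun_of_mem_span_image [Fintype ι] {p : ι → Prop} {x : S}
    (hx : x ∈ Ideal.span (u '' {k | p k})) :
    ∃ b : ι → S, (∀ k, ¬ p k → b k = 0) ∧ ∑ k, b k * u k = x := by
  classical
  have hle : Ideal.span (u '' {k | p k}) ≤ Ideal.span (Set.range fun k => if p k then u k else 0) := by
    refine Ideal.span_le.mpr ?_
    rintro _ ⟨k, hk, rfl⟩
    have hk' : p k := hk
    exact Ideal.subset_span ⟨k, by simp [hk']⟩
  obtain ⟨b, hb⟩ := (Submodule.mem_span_range_iff_exists_fun S).mp (hle hx)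
  refine ⟨fun k => if p k then b k else 0, fun k hk => if_neg hk, ?_⟩
  rw [← hb]
  refine Finset.sum_congr rfl fun k _ => ?_
  by_cases hk : p k <;> simp [hk, smul_eq_mul]

end Filtration

end E2Span

end Summit.ResolutionOfSingularities.ResolutionOfSingularities.Cruxes.HypersurfaceCentreConstruction.LocalEngine

end
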